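import Summits.QuantumFields.YangMills.Theorems.FluctuationComparisonRegPrIntLOrganTangentFibreMeanVersionMW
import Summits.QuantumFields.YangMills.Theorems.FluctuationComparisonRegPrIntLOrganTangentAPackageDescendTo
import Literature.MathematicalPhysics.QuantumFieldTheory.Balaban1983to89.BalabanAdmissibleClassParams
import Literature.MathematicalPhysics.QuantumFieldTheory.Balaban1983to89.T4AveragingDisintegration
import Literature.MathematicalPhysics.QuantumFieldTheory.Balaban1983to89.T4CubeChartExp
import HarnessLib

/-!
# «SPREAD-FIBRE-LAW-HJ» v0.2 — THE JENSEN SUPERSET ROW (LEAD w3 g26 DESIGN CALL №32 (d) ∕ ★★OWNER RULING №73 (iii); (HV′) block = px5 g19 docking list a6079895 §2 AS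
# CORRECTED by px5 g20's DESIGN «NO» 2026-08-31T06:07:57Z and LEAD DESIGN CALL №33 R1–R5 — block TEXT pen px5 g20 (`FibreLawHJ.v0.2.HV-BLOCK.px5g20.txt`, ws16
# 6b64e12142fdd076, spliced VERBATIM), file∕assembly pen ideator ym-r3-idea-1 g28, whose independent cut agrees on (JV1-h)(JV2-h)(JV3-h′)(JV4-h′) to the character).  HONEST: ONE `def … : Prop` — a
# HYPOTHESIS schema; nothing of Bałaban's is asserted or proved; its consumer (LEAD g26's Jensen knit `SpreadFibreLawHJ → JVARᵘ-H″`) and the Theorems-side projection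
# `SpreadFibreLawHJ → SpreadFibreLawH` (px19 g20) are theirs; `SpreadFibreLawH(J)`, LIN″, JEN″, JVARᵘ-H″, O1ᵘ-H v2.2, the five registered stubs, crux 20520 and `YM3TorusSU2`
# are NOT proved; rung R3 = SU(2) YM₃ on T³ — NOT d = 4, NOT infinite volume, NOT a mass gap, NOT Clay.  Registry (`Lines/semiclassical_s2beta.lean` 3732b7df) and
# `payload.skeleton` untouched; nothing in `Lines/` keys this row.
#
# TEXT = `SpreadFibreLawH` v0.3m (THE FROZEN LIN EDITION, `FibreLawH.lean` 025452cae2e56fb1, def body ws16 833268b9e6d569c4, commit e54afdbdc92e) BYTE-FOR-BYTE — frame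
# (O1ᵘ-H v2.2 blocks ①–⑧, `pW` head), letter package, chart block [0]–[11] incl. `π`, (H) block [12] = (JT-h) ∧ (L1ʲ-h) ∧ (L2ʲ-h) — with exactly TWO insertions: (α) head letters
# `NV1 NV2 NV3 NV4 : ℝ` and tail schedules `δV1 δV2 δV3 δV4 : ℕ → ℝ` appended to the ∃-package, their facts packed as ONE conjunct before `j₀ ≤ j₁` (`0 ≤ NV•`, `0 ≤ δV• n`, and
# per schedule the frame's δ-triple: summable, summable tails, tail·floor² → 0); (β) ONE stride conjunct [12b] «(HV′)» placed RIGHT AFTER (H) (LEAD's LinKnit patterns only GAIN a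
# trailing component: the projection to `SpreadFibreLawH` is a re-pack).  `mwCut`∕`wNum`∕`wgt` are re-declared here byte-equal to the frozen file's (namespace `…FibreLawHJ`;
# `Cruxes/*` modules are not importable on the farm; at the Theorems landing the HJ defs file should `import` LIN's defs file instead — px19 g20's design note).
#
# (HV′) = seed binders of (H) verbatim (`k w`, `x := w∕D_Ts ≤ w₀`, `k ≥ 0`, κ-row-mass `≤ w`, FinePair[h_Ts; k] on the `θ_Ts∕4` window) → (JV0-h) ∧ (JV1-h) ∧ (JV2-h) ∧ (JV3-h′)
# ∧ (JV4-h′).  Notation: `F_X(z) := h_Ts(Φ(X,z))`, `h_Ts = log ρ_Ts − log ρ′_Ts`, `ŵ_t(X,·) := wgt … t X` (the interpolated fibre LAW over `X`), `E_X[g] := ∫ g·ŵ_t(X) dτ`,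
# corners `U V W Y` (`V = U·e^m@B`, `W = U·e^{m′}@B′`, `Y = V·e^{m′}@B′`), `ΔΔF := F_Y − F_V − F_W + F_U`, `Δ₁F := F_V − F_U`, `Δ₂F := F_W − F_U`, `sz := ‖m‖∕(θ_j∕4)`.
# (R1∕F1) ORDER: every kernel bracket is `∃ kV• ≥ 0, ⟨QUADRATIC row (+column) mass Σ_{B′} kV• B B′·e^{κ·tdist_j} ≤ NV•·Dr·w·(w∕D_Ts) + δV• j·D_j⟩ ∧ ∀ t ∈ [0,1], ⟨square clause⟩` —
# ONE t-free kernel for all interpolation times (✓p812220's `W₀ := k′ b b′ * sz` consumes exactly that; Bałaban's bounds are uniform in the interpolation).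
# (R2∕F2) CENTRING: every bracket is centred at ITS OWN integrating law (cumulant form), so that with `𝒱(a,c) := Var_{ŵ_t(c)}[F_a]` the Jensen knit is LEAD's `rebracket`
# `ΔΔ 𝒱(X,X) = [𝒱YY − 𝒱VY − 𝒱WY + 𝒱UY] + [(𝒱VY − 𝒱UY) − (𝒱VV − 𝒱UV)] + [(𝒱WY − 𝒱UY) − (𝒱WW − 𝒱UW)] + [𝒱UY − 𝒱UV − 𝒱UW + 𝒱UU]` and needs NOTHING from (H):
#   (JV0-h) LAW NORMALISATION & SQUARE INTEGRABILITY (LEAD R3; no kernel, no letter): for all window points `X Xw` (`PlaqSmall θ_j∕4` both) and every `t ∈ [0,1]`: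
#           `Integrable ŵ_t(Xw) ∧ ∫ ŵ_t(Xw) dτ = 1 ∧ Integrable F_X·ŵ_t(Xw) ∧ Integrable F_X²·ŵ_t(Xw)` (the knit merges∕splits `𝒱(V,c) − 𝒱(U,c)` by linearity and kills
#           `∫ u_X ŵ_t(Y) = c_X·(1 − ∫ŵ_t(Y))` by normalisation; true on the chart: τ probability, `J ≤ CJ`, `χ ≤ 1`, `ρ` continuous > 0, fibre mass > 0 by [9]);
#   (JV1-h) `Cov_{Xw}(ΔΔF, F_X)`: `∀ c, c = E_{Xw}[F_X] → Integrable ∧ |∫ ΔΔF·(F_X − c)·ŵ_t(Xw)| ≤ kV₁ B B′·sz·sz′`, `X Xw` any window points (knit: `Xw := Y`, `X ∈ {Y,V,W,U}`);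
#   (JV2-h) `Cov_{Xw}(Δ₁F, Δ₂F)`: `cᵢ = E_{Xw}[ΔᵢF] → Integrable ∧ |∫ (Δ₁F − c₁)(Δ₂F − c₂)·ŵ_t(Xw)| ≤ kV₂ B B′·sz·sz′` (knit: `Xw := Y`, factor 2);
#   (JV3-h′) `Δ^{law}_{B′} Cov(Δ_B F, S)` in the TWO-PAIR shape of (L1ʲ-h) (`U₁ V₁ U₂ W₂`, `V₁ = U₁·e^m@B`, `W₂ = U₂·e^{m′}@B′`; `Δ := F_{V₁} − F_{U₁}`, `S := F_{V₁} + F_{U₁}`),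
#           BOTH laws own-centred: `c₁ = E_{W₂}[Δ] → e₁ = E_{W₂}[S] → c₂ = E_{U₂}[Δ] → e₂ = E_{U₂}[S] → Integrable ×2 ∧ |∫ (Δ − c₁)(S − e₁)·ŵ_t(W₂) − ∫ (Δ − c₂)(S − e₂)·ŵ_t(U₂)|
#           ≤ kV₃ B B′·sz·sz′` (a truncated 3-point, decays in d(B,B′)); `kV₃` carries ROW and COLUMN masses (the mirror group uses `kV₃ᵀ`, law edge at `B` via ✓`fourthCorner_lawEdge`);
#   (JV4-h′) `ΔΔ^{law} Var[F_{V00}]` in the (L2ʲ-h) shape (`V00 V10 V01 V11`), FOUR own centrings `c_ab = E_{V_ab}[F_{V00}]`: Integrable ×4 ∧ `|E_{V11}[(F₀₀ − c₁₁)²] − E_{V10}[(F₀₀ −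
#           c₁₀)²] − E_{V01}[(F₀₀ − c₀₁)²] + E_{V00}[(F₀₀ − c₀₀)²]| ≤ kV₄ B B′·sz·sz′` (= `Σ κ₄`, volume-free by tree decay; v0.1's single centring contained `2·a(B)·a′(B′)` — px5's
#           rank-one Gaussian witness: minimal `kV₄ ≡ 2x²` on every pair, row mass ∝ #PBond_j — and is WITHDRAWN).
# (R4) every bracket KEEPS its own `Integrable` conjuncts (INT-CONCL).  (R5) budget for the knit: `k′ := 4kV₁ + 2kV₂ + kV₃ + 2kV₃ᵀ + kV₄`, `C := 4·NV1 + 2·NV2 + 3·NV3 + NV4`,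
# `δ := 4δV1 + 2δV2 + 3δV3 + δV4`, `θ := 1`, `r := rc∕2`; step 2 = w5's ✓(JV)∕(JVs) at the four corners (every t); NOTHING from (H).
# D-4 (pricing ∕ hygiene, desk RULING №71 (2)): `NV•` are h-SPECIFIC ∃-letters on the composite's TRUE connected brackets (curvature-indexed in instr-1 FL-23's sense, (ii)); no
# gradient-transport channel (i); their m-uniformity is the DISCHARGER's ([Balaban1987RG1] Thm 3∕(0.30) + the cluster expansion's tree bound for the truncated 3-∕4-point slots,
# t-interpolated laws; [Balaban1988RG2] (0.3)–(0.12)); instrument row TN-JVAR-3 (instr-1) — UNPRICED at v0.2 beyond px5's toy remark ((JV4-h′) is O(1) in the free toy).  The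
# generic law clauses (S)(L0)–(L22) of v0.3k are NOT here (retired: no consumer; RULING №73).
-/

set_option autoImplicit false

noncomputable section

namespace Summit.QuantumFields.YangMills.Cruxes.FluctuationComparisonRegPrIntL.FibreLawHJ

open MeasureTheory Filter Topology Function
open scoped ENNReal NNReal BigOperators
open Literature.MathematicalPhysics.QuantumFieldTheory.Balaban1983to89 T3ContinuumYM3Torus T3NestedUnitLaws
  T3UnitLawDensityEML T4Continuum BalabanUVClass T3UnitScaleTilt T3LevelShift T3TiltDescent
open T4CubeChartExp (expPt)

/-! ## §1 The weights `ŵ_t` -/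

/-- `χ_{j,Ts}(U)` — the multi-window soft cut of the stride `(j, Ts)` read on the fine field (LINᵘ-H / LEAD draft spelling, product of
`sfCut (θBal (j+1+i)) ∘ descendTo (j+1+i) Ts` over `i < Ts − j`; R-CUT-χ token `max 0 (min 1 ((24∕25·θ − dist1)∕((24∕25 − 1∕2)·θ)))`). -/
def mwCut (F : T3Family) (γ b₀ p₀ : ℝ) (j Ts : ℕ) (U : GaugeField (F.P Ts) 0 ↥(Matrix.specialUnitaryGroup (Fin 2) ℂ)) : ℝ :=
  ∏ i ∈ Finset.range (Ts - j), (if h : j + 1 + i ≤ Ts then (∏ p : Plaq (F.P (j + 1 + i)) 0, max 0 (min 1 ((24 / 25 * θBal F.L γ b₀ p₀ (j + 1 + i)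
    - dist1 (GaugeField.plaqHol (descendTo F ℰp (j + 1 + i) Ts h U) p)) / ((24 / 25 - 1 / 2) * θBal F.L γ b₀ p₀ (j + 1 + i))))) else 1)

/-- Numerator of the interpolated fibre weight: `χ_{j,Ts}(Φ(V,z))·ρ_{Ts}(Φ(V,z))^t·ρ′_{Ts}(Φ(V,z))^{1−t}·J(V,z)` (`t = 0`: LIN's `χ·ρ′·J`). -/
def wNum (F : T3Family) (γ b₀ p₀ : ℝ) (j Ts : ℕ)
    (ρ ρ' : (i : ℕ) → GaugeField (F.P i) 0 ↥(Matrix.specialUnitaryGroup (Fin 2) ℂ) → ℝ) {Z : Type}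
    (Φ : GaugeField (F.P j) 0 ↥(Matrix.specialUnitaryGroup (Fin 2) ℂ) × Z → GaugeField (F.P Ts) 0 ↥(Matrix.specialUnitaryGroup (Fin 2) ℂ))
    (J : GaugeField (F.P j) 0 ↥(Matrix.specialUnitaryGroup (Fin 2) ℂ) × Z → NNReal) (t : ℝ)
    (V : GaugeField (F.P j) 0 ↥(Matrix.specialUnitaryGroup (Fin 2) ℂ)) (z : Z) : ℝ :=
  mwCut F γ b₀ p₀ j Ts (Φ (V, z)) * (Real.rpow (ρ Ts (Φ (V, z))) t * Real.rpow (ρ' Ts (Φ (V, z))) (1 - t)) * (J (V, z) : ℝ)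

/-- The normalised interpolated fibre weight `ŵ_t(V, z) := wNum ∕ ∫ wNum dτ` (the fibre LAW over `V` as a density w.r.t. `τ`). -/
def wgt (F : T3Family) (γ b₀ p₀ : ℝ) (j Ts : ℕ)
    (ρ ρ' : (i : ℕ) → GaugeField (F.P i) 0 ↥(Matrix.specialUnitaryGroup (Fin 2) ℂ) → ℝ) {Z : Type} [MeasurableSpace Z] (τ : Measure Z)
    (Φ : GaugeField (F.P j) 0 ↥(Matrix.specialUnitaryGroup (Fin 2) ℂ) × Z → GaugeField (F.P Ts) 0 ↥(Matrix.specialUnitaryGroup (Fin 2) ℂ))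
    (J : GaugeField (F.P j) 0 ↥(Matrix.specialUnitaryGroup (Fin 2) ℂ) × Z → NNReal) (t : ℝ)
    (V : GaugeField (F.P j) 0 ↥(Matrix.specialUnitaryGroup (Fin 2) ℂ)) (z : Z) : ℝ :=
  wNum F γ b₀ p₀ j Ts ρ ρ' Φ J t V z / (∫ z', wNum F γ b₀ p₀ j Ts ρ ρ' Φ J t V z' ∂τ)

/-! ## §3 The row -/

/-- «SPREAD-FIBRE-LAW-HJ» v0.2 — the Jensen superset row: `SpreadFibreLawH` v0.3m's FROZEN text (frame, letters, chart [0]–[11], (H) [12]) byte-for-byte + head letters `NV1…NV4`, `δV1…δV4` + the stride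
conjunct [12b] (HV′) = (JV0-h) ∧ (JV1-h) ∧ (JV2-h) ∧ (JV3-h′) ∧ (JV4-h′) — t-free kernels, own-law centrings, law normalisation (module docstring; LEAD DESIGN CALL №33 R1–R5, block text px5 g20 6b64e121). XL; NOT PRINTED as a theorem; a HYPOTHESIS row (feeds LEAD g26's Jensen knit toward JVARᵘ-H″; sources of the SHAPES: [Balaban1985Variational]
Thm 1, [Balaban1987RG1] (0.22)–(0.30)∕Thm 3, [Balaban1988RG2] (0.3)–(0.12), [Balaban1985Averaging]; nothing asserted). -/
def SpreadFibreLawHJ : Prop :=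
  ∃ pW : ℝ, ∃ γ₁ : ℝ, 0 < γ₁ ∧ ∀ (F : T3Family) (γ : ℝ), 0 < γ → γ ≤ γ₁ → ∀ (b₀ p₀ : ℝ) (j₀ : ℕ) (prm : ℕ → ClassParams) (η : ℕ → ℝ) (rA : ℝ) (Bρ : ℕ → ℝ), 0 < b₀ → 0 < p₀ → pW ≤ p₀ → AdmissibleClassParams F γ b₀ p₀ prm → (∀ j, 0 ≤ η j) → Summable η → Summable (fun i => ∑' k, η (k + i)) → Tendsto (fun j => (∑' k, η (k + j)) * ((1 + 2 * ((F.L : ℝ) ^ j / γ) * (Fintype.card (Plaq (F.P j) 0) : ℝ)) * (Fintype.card (PBond (F.P j) 0) : ℝ) ^ 2)) atTop (𝓝 0) → 0 < rA → ∃ κ₀ : ℝ, 0 < κ₀ ∧ ∀ (κ : ℝ), 0 < κ → κ ≤ κ₀ → ∃ (rc w₀ NT NX NL CJ NV1 NV2 NV3 NV4 : ℝ) (δT δX δL δV1 δV2 δV3 δV4 : ℕ → ℝ) (j₁ : ℕ), 0 < rc ∧ 0 < w₀ ∧ 0 ≤ NT ∧ 0 ≤ NX ∧ 0 ≤ NL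 ∧ 0 ≤ CJ ∧ (∀ n, 0 ≤ δT n ∧ 0 ≤ δX n ∧ 0 ≤ δL n) ∧ Summable δT ∧ Summable (fun i => ∑' k, δT (k + i)) ∧ Tendsto (fun j => (∑' k, δT (k + j)) * ((1 + 2 * ((F.L : ℝ) ^ j / γ) * (Fintype.card (Plaq (F.P j) 0) : ℝ)) * (Fintype.card (PBond (F.P j) 0) : ℝ) ^ 2)) atTop (𝓝 0) ∧ Summable δX ∧ Summable (fun i => ∑' k, δX (k + i)) ∧ Tendsto (fun j => (∑' k, δX (k + j)) * ((1 + 2 * ((F.L : ℝ) ^ j / γ) * (Fintype.card (Plaq (F.P j) 0) : ℝ)) * (Fintype.card (PBond (F.P j) 0) : ℝ) ^ 2)) atTop (𝓝 0) ∧ Summable δL ∧ Summable (fun i => ∑' k, δL (k + i)) ∧ Tendsto (fun j => (∑' k, δL (k + j)) * ((1 + 2 * ((F.L : ℝ) ^ j / γ) * (Fintype.card (Plaq (F.P j) 0) : ℝ)) * (Fintype.card (PBond (F.P j) 0) : ℝ) ^ 2)) atTop (𝓝 0) ∧ (0 ≤ NV1 ∧ 0 ≤ NV2 ∧ 0 ≤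 NV3 ∧ 0 ≤ NV4 ∧ (∀ n, 0 ≤ δV1 n ∧ 0 ≤ δV2 n ∧ 0 ≤ δV3 n ∧ 0 ≤ δV4 n) ∧ (Summable δV1 ∧ Summable (fun i => ∑' k, δV1 (k + i)) ∧ Tendsto (fun j => (∑' k, δV1 (k + j)) * ((1 + 2 * ((F.L : ℝ) ^ j / γ) * (Fintype.card (Plaq (F.P j) 0) : ℝ)) * (Fintype.card (PBond (F.P j) 0) : ℝ) ^ 2)) atTop (𝓝 0)) ∧ (Summable δV2 ∧ Summable (fun i => ∑' k, δV2 (k + i)) ∧ Tendsto (fun j => (∑' k, δV2 (k + j)) * ((1 + 2 * ((F.L : ℝ) ^ j / γ) * (Fintype.card (Plaq (F.P j) 0) : ℝ)) * (Fintype.card (PBond (F.P j) 0) : ℝ) ^ 2)) atTop (𝓝 0)) ∧ (Summable δV3 ∧ Summable (fun i => ∑' k, δV3 (k + i)) ∧ Tendsto (fun j => (∑' k, δV3 (k + j)) * ((1 + 2 * ((F.L : ℝ) ^ j / γ) * (Fintype.card (Plaq (F.P j) 0) : ℝ)) * (Fintype.card (PBond (F.P j) 0) : ℝ) ^ 2))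 atTop (𝓝 0)) ∧ (Summable δV4 ∧ Summable (fun i => ∑' k, δV4 (k + i)) ∧ Tendsto (fun j => (∑' k, δV4 (k + j)) * ((1 + 2 * ((F.L : ℝ) ^ j / γ) * (Fintype.card (Plaq (F.P j) 0) : ℝ)) * (Fintype.card (PBond (F.P j) 0) : ℝ) ^ 2)) atTop (𝓝 0))) ∧ j₀ ≤ j₁ ∧ ∀ (ν : ℕ → (j : ℕ) → MeasureTheory.Measure (GaugeField (F.P j) 0 ↥(Matrix.specialUnitaryGroup (Fin 2) ℂ))), (∀ K, ν K K = T4GenFunBounds.gibbsMeasure (F.P K) ((F.scheme ℰp γ).β K)) → (∀ K j, j < K → ν K j = Measure.map (descend F ℰp j) (ν K (j + 1))) → ∀ (K K' : ℕ), K ≤ K' → ∀ (Ts T : ℕ), Ts < T → T ≤ K → ∀ (μ μ' : ((j : ℕ) → MeasureTheory.Measure (GaugeField (F.P j) 0 ↥(Matrix.specialUnitaryGroup (Fin 2) ℂ)))) (ρ ρ' : ((j : ℕ) → GaugeField (F.P j) 0 ↥(Matrix.specialUnitaryGroup (Fin 2) ℂ) → ℝ)), (∀ j : ℕ, Ts ≤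 j → j ≤ T → μ j = ν K j ∧ μ' j = ν K' j) → (∀ j : ℕ, j < Ts → μ j = Measure.map (descend F ℰp j) ((μ (j + 1)).withDensity (fun U => ENNReal.ofReal ((∏ p : Plaq _ _, max 0 (min 1 ((24 / 25 * (θBal F.L γ b₀ p₀ (j + 1)) - dist1 (GaugeField.plaqHol U p)) / ((24 / 25 - 1 / 2) * (θBal F.L γ b₀ p₀ (j + 1))))))))) ∧ μ' j = Measure.map (descend F ℰp j) ((μ' (j + 1)).withDensity (fun U => ENNReal.ofReal ((∏ p : Plaq _ _, max 0 (min 1 ((24 / 25 * (θBal F.L γ b₀ p₀ (j + 1)) - dist1 (GaugeField.plaqHol U p)) / ((24 / 25 - 1 / 2) * (θBal F.L γ b₀ p₀ (j + 1)))))))))) → (∀ j : ℕ, Ts ≤ j → j < T → μ j = Measure.map (descend F ℰp j) (μ (j + 1)) ∧ μ' j = Measure.map (descend F ℰp j) (μ' (j + 1))) → (∀ j : ℕ, j ≤ T → IsFiniteMeasure (μ j) ∧ IsFiniteMeasure (μ' j)) → (∀ j : ℕ, j₀ ≤ j → j ≤ T → ((∀ U, PlaqSmall (θBal F.L γ b₀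 p₀ j) U → 0 < ρ j U ∧ 0 < ρ' j U) ∧ μ j = (fieldMeasure _ _ _).withDensity (fun U => ENNReal.ofReal (ρ j U)) ∧ μ' j = (fieldMeasure _ _ _).withDensity (fun U => ENNReal.ofReal (ρ' j U)) ∧ (∃ κ : ℝ, MemAtHeight F ℰp j (prm j) (fun U => Real.exp κ * ρ j U)) ∧ (∃ κ : ℝ, MemAtHeight F ℰp j (prm j) (fun U => Real.exp κ * ρ' j U)) ∧ μ j {U | ¬ PlaqSmall (θBal F.L γ b₀ p₀ j) U} ≤ ENNReal.ofReal (η j) ∧ μ' j {U | ¬ PlaqSmall (θBal F.L γ b₀ p₀ j) U} ≤ ENNReal.ofReal (η j) ∧ (ContinuousOn (ρ j) {U | PlaqSmall (θBal F.L γ b₀ p₀ j) U} ∧ ContinuousOn (ρ' j) {U | PlaqSmall (θBal F.L γ b₀ p₀ j) U}) ∧ ((∀ (U : GaugeField _ _ ↥(Matrix.specialUnitaryGroup (Fin 2) ℂ)), PlaqSmall (49 / 50 * θBal F.L γ b₀ p₀ j) U → ∀ (b b' : PBond _ _) (v v' : Fin 3 → ℝ), ‖v‖ ≤ 1 → ‖v'‖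 ≤ 1 → ∃ g : ℂ × ℂ → ℂ, DifferentiableOn ℂ g (Metric.ball (0 : ℂ) (rA * (49 / 50 * θBal F.L γ b₀ p₀ j)) ×ˢ Metric.ball (0 : ℂ) (rA * (49 / 50 * θBal F.L γ b₀ p₀ j))) ∧ (∀ (s t : ℝ) (V Z : GaugeField _ _ ↥(Matrix.specialUnitaryGroup (Fin 2) ℂ)), |s| < rA * (49 / 50 * θBal F.L γ b₀ p₀ j) → |t| < rA * (49 / 50 * θBal F.L γ b₀ p₀ j) → (∀ e, e ≠ b → V e = U e) → V b = U b * expPt (s • v) → (∀ e, e ≠ b' → Z e = V e) → Z b' = V b' * expPt (t • v') → g ((s : ℂ), (t : ℂ)) = (((Real.log (ρ j Z)) : ℝ) : ℂ)) ∧ ∀ z ∈ Metric.ball (0 : ℂ) (rA * (49 / 50 * θBal F.L γ b₀ p₀ j)) ×ˢ Metric.ball (0 : ℂ) (rA * (49 / 50 * θBal F.L γ b₀ p₀ j)), ‖g z - g 0‖ ≤ (Bρ j)) ∧ (∀ (U : GaugeField _ _ ↥(Matrix.specialUnitaryGroup (Fin 2) ℂ)), PlaqSmall (49 / 50 * θBal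 F.L γ b₀ p₀ j) U → ∀ (b b' : PBond _ _) (v v' : Fin 3 → ℝ), ‖v‖ ≤ 1 → ‖v'‖ ≤ 1 → ∃ g : ℂ × ℂ → ℂ, DifferentiableOn ℂ g (Metric.ball (0 : ℂ) (rA * (49 / 50 * θBal F.L γ b₀ p₀ j)) ×ˢ Metric.ball (0 : ℂ) (rA * (49 / 50 * θBal F.L γ b₀ p₀ j))) ∧ (∀ (s t : ℝ) (V Z : GaugeField _ _ ↥(Matrix.specialUnitaryGroup (Fin 2) ℂ)), |s| < rA * (49 / 50 * θBal F.L γ b₀ p₀ j) → |t| < rA * (49 / 50 * θBal F.L γ b₀ p₀ j) → (∀ e, e ≠ b → V e = U e) → V b = U b * expPt (s • v) → (∀ e, e ≠ b' → Z e = V e) → Z b' = V b' * expPt (t • v') → g ((s : ℂ), (t : ℂ)) = (((Real.log (ρ' j Z)) : ℝ) : ℂ)) ∧ ∀ z ∈ Metric.ball (0 : ℂ) (rA * (49 / 50 * θBal F.L γ b₀ p₀ j)) ×ˢ Metric.ball (0 : ℂ) (rA * (49 / 50 * θBal F.L γ b₀ p₀ j)), ‖g z - g 0‖ ≤ (Bρ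 j))))) → ∀ (j : ℕ), j₁ ≤ j → ∀ (hjTs : j + 1 ≤ Ts), ∃ (Z : Type) (_ : MeasurableSpace Z) (τ : MeasureTheory.Measure Z) (Φ : GaugeField (F.P j) 0 ↥(Matrix.specialUnitaryGroup (Fin 2) ℂ) × Z → GaugeField (F.P Ts) 0 ↥(Matrix.specialUnitaryGroup (Fin 2) ℂ)) (J : GaugeField (F.P j) 0 ↥(Matrix.specialUnitaryGroup (Fin 2) ℂ) × Z → NNReal) (S : Set (GaugeField (F.P Ts) 0 ↥(Matrix.specialUnitaryGroup (Fin 2) ℂ))) (π : Site (F.P Ts) 0 → Site (F.P j) 0), MeasureTheory.IsProbabilityMeasure τ ∧ Measurable Φ ∧ Measurable J ∧ MeasurableSet S ∧ (∀ U : GaugeField (F.P Ts) 0 ↥(Matrix.specialUnitaryGroup (Fin 2) ℂ), (∀ (n : ℕ) (hjn : j + 1 ≤ n) (hnK : n ≤ Ts), PlaqSmall (24 / 25 * θBal F.L γ b₀ p₀ n) (descendTo F ℰp n Ts hnK U)) → U ∈ S) ∧ (∀ V z, descendTo F ℰp j Ts (Nat.le_of_succ_le hjTs) (Φ (V, z))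 = V) ∧ (∀ A : Set (GaugeField (F.P j) 0 ↥(Matrix.specialUnitaryGroup (Fin 2) ℂ)), MeasurableSet A → (fieldMeasure (F.P Ts) 0 ↥(Matrix.specialUnitaryGroup (Fin 2) ℂ)).restrict (descendTo F ℰp j Ts (Nat.le_of_succ_le hjTs) ⁻¹' A ∩ S) = ((((fieldMeasure (F.P j) 0 ↥(Matrix.specialUnitaryGroup (Fin 2) ℂ)).restrict A).prod τ).withDensity (fun p => (J p : ENNReal))).map Φ) ∧ (∀ f : GaugeField (F.P Ts) 0 ↥(Matrix.specialUnitaryGroup (Fin 2) ℂ) → ℝ, Continuous f → (∀ U, f U ≠ 0 → (∀ (n : ℕ) (hjn : j + 1 ≤ n) (hnK : n ≤ Ts), PlaqSmall (24 / 25 * θBal F.L γ b₀ p₀ n) (descendTo F ℰp n Ts hnK U))) → ∀ z, ContinuousOn (fun V => (J (V, z) : ℝ) * f (Φ (V, z))) {V | PlaqSmall (θBal F.L γ b₀ p₀ j) V}) ∧ (∀ V z, (J (V, z) : ℝ) ≤ CJ) ∧ (∀ V, PlaqSmall (θBal F.L γ b₀ p₀ j) V → 0 < ∫⁻ z in {z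 | (∀ (n : ℕ) (hjn : j + 1 ≤ n) (hnK : n ≤ Ts), PlaqSmall (24 / 25 * θBal F.L γ b₀ p₀ n) (descendTo F ℰp n Ts hnK (Φ (V, z))))}, (J (V, z) : ENNReal) ∂τ) ∧ (∀ x y : Site (F.P Ts) 0, (((π x).tdist (π y) : ℕ) : ℝ) ≤ ((x.tdist y : ℕ) : ℝ)) ∧ (∀ y : Site (F.P j) 0, ∃ s : Finset (Site (F.P Ts) 0), (∀ x, π x = y → x ∈ s) ∧ (s.card : ℝ) ≤ ((F.L : ℝ) ^ (Ts - j)) ^ 3) ∧ (∀ (k : PBond (F.P Ts) 0 → PBond (F.P Ts) 0 → ℝ) (w : ℝ), 0 ≤ w → w / (((F.L : ℝ) ^ Ts / γ) * θBal F.L γ b₀ p₀ Ts ^ 2) ≤ w₀ → (∀ b b', 0 ≤ k b b') → (∀ b, ∑ b', k b b' * Real.exp (κ * (b.src.tdist b'.src : ℝ)) ≤ w) → (∀ (b b' : PBond (F.P Ts) 0) (v v' : Fin 3 → ℝ) (U V W Y : GaugeField (F.P Ts) 0 ↥(Matrix.specialUnitaryGroup (Fin 2) ℂ)), ‖v‖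 ≤ (rA / 2) * (θBal F.L γ b₀ p₀ Ts / 4) → ‖v'‖ ≤ (rA / 2) * (θBal F.L γ b₀ p₀ Ts / 4) → PlaqSmall (θBal F.L γ b₀ p₀ Ts / 4) U → PlaqSmall (θBal F.L γ b₀ p₀ Ts / 4) V → PlaqSmall (θBal F.L γ b₀ p₀ Ts / 4) W → PlaqSmall (θBal F.L γ b₀ p₀ Ts / 4) Y → (∀ e, e ≠ b → V e = U e) → V b = U b * expPt v → (∀ e, e ≠ b' → W e = U e) → W b' = U b' * expPt v' → (∀ e, e ≠ b' → Y e = V e) → Y b' = V b' * expPt v' → |(Real.log (ρ Ts Y) - Real.log (ρ' Ts Y)) - (Real.log (ρ Ts V) - Real.log (ρ' Ts V)) - (Real.log (ρ Ts W) - Real.log (ρ' Ts W)) + (Real.log (ρ Ts U) - Real.log (ρ' Ts U))| ≤ k b b' * (‖v‖ / (θBal F.L γ b₀ p₀ Ts / 4)) * (‖v'‖ / (θBal F.L γ b₀ p₀ Ts / 4))) → (∀ t : ℝ, 0 ≤ t → t ≤ 1 → ∃ k' : PBond (F.P j) 0 → PBond (F.P j) 0 → ℝ, (∀ B B', 0 ≤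 k' B B') ∧ (∀ B, ∑ B', k' B B' * Real.exp (κ * (B.src.tdist B'.src : ℝ)) ≤ NT * ((((F.L : ℝ) ^ j / γ) * θBal F.L γ b₀ p₀ j ^ 2) / (((F.L : ℝ) ^ Ts / γ) * θBal F.L γ b₀ p₀ Ts ^ 2)) * w + δT j * (((F.L : ℝ) ^ j / γ) * θBal F.L γ b₀ p₀ j ^ 2)) ∧ (∀ (B B' : PBond (F.P j) 0) (m m' : Fin 3 → ℝ) (U V W Y Xw : GaugeField (F.P j) 0 ↥(Matrix.specialUnitaryGroup (Fin 2) ℂ)), ‖m‖ ≤ rc * (θBal F.L γ b₀ p₀ j / 4) → ‖m'‖ ≤ rc * (θBal F.L γ b₀ p₀ j / 4) → PlaqSmall (θBal F.L γ b₀ p₀ j / 4) U → PlaqSmall (θBal F.L γ b₀ p₀ j / 4) V → PlaqSmall (θBal F.L γ b₀ p₀ j / 4) W → PlaqSmall (θBal F.L γ b₀ p₀ j / 4) Y → PlaqSmall (θBal F.L γ b₀ p₀ j / 4) Xw → (∀ e, e ≠ B → V e = U e) → V B = U B * expPt m → (∀ e, e ≠ B' → W e = U e) → W B' = U B' * expPt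 m' → (∀ e, e ≠ B' → Y e = V e) → Y B' = V B' * expPt m' → Integrable (fun z => (Real.log (ρ Ts (Φ (U, z))) - Real.log (ρ' Ts (Φ (U, z)))) * (wgt F γ b₀ p₀ j Ts ρ ρ' τ Φ J t) Xw z) τ ∧ Integrable (fun z => (Real.log (ρ Ts (Φ (V, z))) - Real.log (ρ' Ts (Φ (V, z)))) * (wgt F γ b₀ p₀ j Ts ρ ρ' τ Φ J t) Xw z) τ ∧ Integrable (fun z => (Real.log (ρ Ts (Φ (W, z))) - Real.log (ρ' Ts (Φ (W, z)))) * (wgt F γ b₀ p₀ j Ts ρ ρ' τ Φ J t) Xw z) τ ∧ Integrable (fun z => (Real.log (ρ Ts (Φ (Y, z))) - Real.log (ρ' Ts (Φ (Y, z)))) * (wgt F γ b₀ p₀ j Ts ρ ρ' τ Φ J t) Xw z) τ ∧ |∫ z, ((Real.log (ρ Ts (Φ (Y, z))) - Real.log (ρ' Ts (Φ (Y, z)))) - (Real.log (ρ Ts (Φ (V, z))) - Real.log (ρ' Ts (Φ (V, z)))) - (Real.log (ρ Ts (Φ (W, z))) - Real.log (ρ' Ts (Φ (W, z)))) + (Real.log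 (ρ Ts (Φ (U, z))) - Real.log (ρ' Ts (Φ (U, z))))) * (wgt F γ b₀ p₀ j Ts ρ ρ' τ Φ J t) Xw z ∂τ| ≤ k' B B' * (‖m‖ / (θBal F.L γ b₀ p₀ j / 4)) * (‖m'‖ / (θBal F.L γ b₀ p₀ j / 4)))) ∧ (∀ t : ℝ, 0 ≤ t → t ≤ 1 → ∃ kX : PBond (F.P j) 0 → PBond (F.P j) 0 → ℝ, (∀ B B', 0 ≤ kX B B') ∧ (∀ B, ∑ B', kX B B' * Real.exp (κ * (B.src.tdist B'.src : ℝ)) ≤ NX * ((((F.L : ℝ) ^ j / γ) * θBal F.L γ b₀ p₀ j ^ 2) / (((F.L : ℝ) ^ Ts / γ) * θBal F.L γ b₀ p₀ Ts ^ 2)) * w + δX j * (((F.L : ℝ) ^ j / γ) * θBal F.L γ b₀ p₀ j ^ 2)) ∧ (∀ B', ∑ B, kX B B' * Real.exp (κ * (B.src.tdist B'.src : ℝ)) ≤ NX * ((((F.L : ℝ) ^ j / γ) * θBal F.L γ b₀ p₀ j ^ 2) / (((F.L : ℝ) ^ Ts / γ) * θBal F.L γ b₀ p₀ Ts ^ 2))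 * w + δX j * (((F.L : ℝ) ^ j / γ) * θBal F.L γ b₀ p₀ j ^ 2)) ∧ (∀ (B B' : PBond (F.P j) 0) (m m' : Fin 3 → ℝ) (U₁ V₁ U₂ W₂ : GaugeField (F.P j) 0 ↥(Matrix.specialUnitaryGroup (Fin 2) ℂ)), ‖m‖ ≤ rc * (θBal F.L γ b₀ p₀ j / 4) → ‖m'‖ ≤ rc * (θBal F.L γ b₀ p₀ j / 4) → PlaqSmall (θBal F.L γ b₀ p₀ j / 4) U₁ → PlaqSmall (θBal F.L γ b₀ p₀ j / 4) V₁ → PlaqSmall (θBal F.L γ b₀ p₀ j / 4) U₂ → PlaqSmall (θBal F.L γ b₀ p₀ j / 4) W₂ → (∀ e, e ≠ B → V₁ e = U₁ e) → V₁ B = U₁ B * expPt m → (∀ e, e ≠ B' → W₂ e = U₂ e) → W₂ B' = U₂ B' * expPt m' → Integrable (fun z => (Real.log (ρ Ts (Φ (U₁, z))) - Real.log (ρ' Ts (Φ (U₁, z)))) * (wgt F γ b₀ p₀ j Ts ρ ρ' τ Φ J t) U₂ z) τ ∧ Integrable (fun z => (Real.log (ρ Ts (Φ (V₁, z))) - Real.log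 (ρ' Ts (Φ (V₁, z)))) * (wgt F γ b₀ p₀ j Ts ρ ρ' τ Φ J t) U₂ z) τ ∧ Integrable (fun z => (Real.log (ρ Ts (Φ (U₁, z))) - Real.log (ρ' Ts (Φ (U₁, z)))) * (wgt F γ b₀ p₀ j Ts ρ ρ' τ Φ J t) W₂ z) τ ∧ Integrable (fun z => (Real.log (ρ Ts (Φ (V₁, z))) - Real.log (ρ' Ts (Φ (V₁, z)))) * (wgt F γ b₀ p₀ j Ts ρ ρ' τ Φ J t) W₂ z) τ ∧ |((∫ z, (Real.log (ρ Ts (Φ (V₁, z))) - Real.log (ρ' Ts (Φ (V₁, z)))) * (wgt F γ b₀ p₀ j Ts ρ ρ' τ Φ J t) W₂ z ∂τ) - (∫ z, (Real.log (ρ Ts (Φ (U₁, z))) - Real.log (ρ' Ts (Φ (U₁, z)))) * (wgt F γ b₀ p₀ j Ts ρ ρ' τ Φ J t) W₂ z ∂τ)) - ((∫ z, (Real.log (ρ Ts (Φ (V₁, z))) - Real.log (ρ' Ts (Φ (V₁, z)))) * (wgt F γ b₀ p₀ j Ts ρ ρ' τ Φ J t) U₂ z ∂τ) - (∫ z, (Real.log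 (ρ Ts (Φ (U₁, z))) - Real.log (ρ' Ts (Φ (U₁, z)))) * (wgt F γ b₀ p₀ j Ts ρ ρ' τ Φ J t) U₂ z ∂τ))| ≤ kX B B' * (‖m‖ / (θBal F.L γ b₀ p₀ j / 4)) * (‖m'‖ / (θBal F.L γ b₀ p₀ j / 4)))) ∧ (∀ t : ℝ, 0 ≤ t → t ≤ 1 → ∃ kL : PBond (F.P j) 0 → PBond (F.P j) 0 → ℝ, (∀ B B', 0 ≤ kL B B') ∧ (∀ B, ∑ B', kL B B' * Real.exp (κ * (B.src.tdist B'.src : ℝ)) ≤ NL * ((((F.L : ℝ) ^ j / γ) * θBal F.L γ b₀ p₀ j ^ 2) / (((F.L : ℝ) ^ Ts / γ) * θBal F.L γ b₀ p₀ Ts ^ 2)) * w + δL j * (((F.L : ℝ) ^ j / γ) * θBal F.L γ b₀ p₀ j ^ 2)) ∧ (∀ (B B' : PBond (F.P j) 0) (m m' : Fin 3 → ℝ) (V00 V10 V01 V11 : GaugeField (F.P j) 0 ↥(Matrix.specialUnitaryGroup (Fin 2) ℂ)), ‖m‖ ≤ rc * (θBal F.L γ b₀ p₀ j / 4) → ‖m'‖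 ≤ rc * (θBal F.L γ b₀ p₀ j / 4) → PlaqSmall (θBal F.L γ b₀ p₀ j / 4) V00 → PlaqSmall (θBal F.L γ b₀ p₀ j / 4) V10 → PlaqSmall (θBal F.L γ b₀ p₀ j / 4) V01 → PlaqSmall (θBal F.L γ b₀ p₀ j / 4) V11 → (∀ e, e ≠ B → V10 e = V00 e) → V10 B = V00 B * expPt m → (∀ e, e ≠ B' → V01 e = V00 e) → V01 B' = V00 B' * expPt m' → (∀ e, e ≠ B' → V11 e = V10 e) → V11 B' = V10 B' * expPt m' → Integrable (fun z => (Real.log (ρ Ts (Φ (V00, z))) - Real.log (ρ' Ts (Φ (V00, z)))) * (wgt F γ b₀ p₀ j Ts ρ ρ' τ Φ J t) V00 z) τ ∧ Integrable (fun z => (Real.log (ρ Ts (Φ (V00, z))) - Real.log (ρ' Ts (Φ (V00, z)))) * (wgt F γ b₀ p₀ j Ts ρ ρ' τ Φ J t) V10 z) τ ∧ Integrable (fun z => (Real.log (ρ Ts (Φ (V00, z))) - Real.log (ρ' Ts (Φ (V00, z)))) * (wgt F γ b₀ p₀ j Ts ρ ρ' τ Φ J t) V01 z) τ ∧ Integrable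 (fun z => (Real.log (ρ Ts (Φ (V00, z))) - Real.log (ρ' Ts (Φ (V00, z)))) * (wgt F γ b₀ p₀ j Ts ρ ρ' τ Φ J t) V11 z) τ ∧ |(∫ z, (Real.log (ρ Ts (Φ (V00, z))) - Real.log (ρ' Ts (Φ (V00, z)))) * (wgt F γ b₀ p₀ j Ts ρ ρ' τ Φ J t) V11 z ∂τ) - (∫ z, (Real.log (ρ Ts (Φ (V00, z))) - Real.log (ρ' Ts (Φ (V00, z)))) * (wgt F γ b₀ p₀ j Ts ρ ρ' τ Φ J t) V10 z ∂τ) - (∫ z, (Real.log (ρ Ts (Φ (V00, z))) - Real.log (ρ' Ts (Φ (V00, z)))) * (wgt F γ b₀ p₀ j Ts ρ ρ' τ Φ J t) V01 z ∂τ) + (∫ z, (Real.log (ρ Ts (Φ (V00, z))) - Real.log (ρ' Ts (Φ (V00, z)))) * (wgt F γ b₀ p₀ j Ts ρ ρ' τ Φ J t) V00 z ∂τ)| ≤ kL B B' * (‖m‖ / (θBal F.L γ b₀ p₀ j / 4)) * (‖m'‖ / (θBal F.L γ b₀ p₀ j / 4))))) ∧ (∀ (k : PBond (F.P Ts) 0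 → PBond (F.P Ts) 0 → ℝ) (w : ℝ), 0 ≤ w → w / (((F.L : ℝ) ^ Ts / γ) * θBal F.L γ b₀ p₀ Ts ^ 2) ≤ w₀ → (∀ b b', 0 ≤ k b b') → (∀ b, ∑ b', k b b' * Real.exp (κ * (b.src.tdist b'.src : ℝ)) ≤ w) → (∀ (b b' : PBond (F.P Ts) 0) (v v' : Fin 3 → ℝ) (U V W Y : GaugeField (F.P Ts) 0 ↥(Matrix.specialUnitaryGroup (Fin 2) ℂ)), ‖v‖ ≤ (rA / 2) * (θBal F.L γ b₀ p₀ Ts / 4) → ‖v'‖ ≤ (rA / 2) * (θBal F.L γ b₀ p₀ Ts / 4) → PlaqSmall (θBal F.L γ b₀ p₀ Ts / 4) U → PlaqSmall (θBal F.L γ b₀ p₀ Ts / 4) V → PlaqSmall (θBal F.L γ b₀ p₀ Ts / 4) W → PlaqSmall (θBal F.L γ b₀ p₀ Ts / 4) Y → (∀ e, e ≠ b → V e = U e) → V b = U b * expPt v → (∀ e, e ≠ b' → W e = U e) → W b' = U b' * expPt v' → (∀ e, e ≠ b' → Y e = V e) → Y b' = V b' * expPt v' → |(Real.log (ρ Ts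 Y) - Real.log (ρ' Ts Y)) - (Real.log (ρ Ts V) - Real.log (ρ' Ts V)) - (Real.log (ρ Ts W) - Real.log (ρ' Ts W)) + (Real.log (ρ Ts U) - Real.log (ρ' Ts U))| ≤ k b b' * (‖v‖ / (θBal F.L γ b₀ p₀ Ts / 4)) * (‖v'‖ / (θBal F.L γ b₀ p₀ Ts / 4))) →
(∀ t : ℝ, 0 ≤ t → t ≤ 1 → ∀ (X Xw : GaugeField (F.P j) 0 ↥(Matrix.specialUnitaryGroup (Fin 2) ℂ)), PlaqSmall (θBal F.L γ b₀ p₀ j / 4) X → PlaqSmall (θBal F.L γ b₀ p₀ j / 4) Xw → Integrable (fun z => (wgt F γ b₀ p₀ j Ts ρ ρ' τ Φ J t) Xw z) τ ∧ ∫ z, (wgt F γ b₀ p₀ j Ts ρ ρ' τ Φ J t) Xw z ∂τ = 1 ∧ Integrable (fun z => (Real.log (ρ Ts (Φ (X, z))) - Real.log (ρ' Ts (Φ (X, z)))) * (wgt F γ b₀ p₀ j Ts ρ ρ' τ Φ J t) Xw z) τ ∧ Integrable (fun z => (Real.log (ρ Ts (Φ (X, z))) - Real.log (ρ' Ts (Φ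 (X, z)))) ^ 2 * (wgt F γ b₀ p₀ j Ts ρ ρ' τ Φ J t) Xw z) τ)
∧ (∃ kV₁ : PBond (F.P j) 0 → PBond (F.P j) 0 → ℝ, (∀ B B', 0 ≤ kV₁ B B') ∧ (∀ B, ∑ B', kV₁ B B' * Real.exp (κ * (B.src.tdist B'.src : ℝ)) ≤ NV1 * ((((F.L : ℝ) ^ j / γ) * θBal F.L γ b₀ p₀ j ^ 2) / (((F.L : ℝ) ^ Ts / γ) * θBal F.L γ b₀ p₀ Ts ^ 2)) * w * (w / (((F.L : ℝ) ^ Ts / γ) * θBal F.L γ b₀ p₀ Ts ^ 2)) + δV1 j * (((F.L : ℝ) ^ j / γ) * θBal F.L γ b₀ p₀ j ^ 2)) ∧ ∀ t : ℝ, 0 ≤ t → t ≤ 1 → (∀ (B B' : PBond (F.P j) 0) (m m' : Fin 3 → ℝ) (U V W Y X Xw : GaugeField (F.P j) 0 ↥(Matrix.specialUnitaryGroup (Fin 2) ℂ)), ‖m‖ ≤ rc * (θBal F.L γ b₀ p₀ j / 4) → ‖m'‖ ≤ rc * (θBal F.L γ b₀ p₀ j / 4) → PlaqSmall (θBal F.L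 γ b₀ p₀ j / 4) U → PlaqSmall (θBal F.L γ b₀ p₀ j / 4) V → PlaqSmall (θBal F.L γ b₀ p₀ j / 4) W → PlaqSmall (θBal F.L γ b₀ p₀ j / 4) Y → PlaqSmall (θBal F.L γ b₀ p₀ j / 4) X → PlaqSmall (θBal F.L γ b₀ p₀ j / 4) Xw → (∀ e, e ≠ B → V e = U e) → V B = U B * expPt m → (∀ e, e ≠ B' → W e = U e) → W B' = U B' * expPt m' → (∀ e, e ≠ B' → Y e = V e) → Y B' = V B' * expPt m' → ∀ (c : ℝ), c = ∫ z, (Real.log (ρ Ts (Φ (X, z))) - Real.log (ρ' Ts (Φ (X, z)))) * (wgt F γ b₀ p₀ j Ts ρ ρ' τ Φ J t) Xw z ∂τ → Integrable (fun z => ((Real.log (ρ Ts (Φ (Y, z))) - Real.log (ρ' Ts (Φ (Y, z)))) - (Real.log (ρ Ts (Φ (V, z))) - Real.log (ρ' Ts (Φ (V, z)))) - (Real.log (ρ Ts (Φ (W, z))) - Real.log (ρ' Ts (Φ (W, z)))) + (Real.log (ρ Ts (Φ (U, z))) - Real.log (ρ' Ts (Φ (U, z))))) * ((Real.log (ρ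 Ts (Φ (X, z))) - Real.log (ρ' Ts (Φ (X, z)))) - c) * (wgt F γ b₀ p₀ j Ts ρ ρ' τ Φ J t) Xw z) τ ∧ |∫ z, ((Real.log (ρ Ts (Φ (Y, z))) - Real.log (ρ' Ts (Φ (Y, z)))) - (Real.log (ρ Ts (Φ (V, z))) - Real.log (ρ' Ts (Φ (V, z)))) - (Real.log (ρ Ts (Φ (W, z))) - Real.log (ρ' Ts (Φ (W, z)))) + (Real.log (ρ Ts (Φ (U, z))) - Real.log (ρ' Ts (Φ (U, z))))) * ((Real.log (ρ Ts (Φ (X, z))) - Real.log (ρ' Ts (Φ (X, z)))) - c) * (wgt F γ b₀ p₀ j Ts ρ ρ' τ Φ J t) Xw z ∂τ| ≤ kV₁ B B' * (‖m‖ / (θBal F.L γ b₀ p₀ j / 4)) * (‖m'‖ / (θBal F.L γ b₀ p₀ j / 4))))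
∧ (∃ kV₂ : PBond (F.P j) 0 → PBond (F.P j) 0 → ℝ, (∀ B B', 0 ≤ kV₂ B B') ∧ (∀ B, ∑ B', kV₂ B B' * Real.exp (κ * (B.src.tdist B'.src : ℝ)) ≤ NV2 * ((((F.L : ℝ) ^ j / γ) * θBal F.L γ b₀ p₀ j ^ 2) / (((F.L : ℝ) ^ Ts / γ) * θBal F.L γ b₀ p₀ Ts ^ 2)) * w * (w / (((F.L : ℝ) ^ Ts / γ) * θBal F.L γ b₀ p₀ Ts ^ 2)) + δV2 j * (((F.L : ℝ) ^ j / γ) * θBal F.L γ b₀ p₀ j ^ 2)) ∧ ∀ t : ℝ, 0 ≤ t → t ≤ 1 → (∀ (B B' : PBond (F.P j) 0) (m m' : Fin 3 → ℝ) (U V W Y Xw : GaugeField (F.P j) 0 ↥(Matrix.specialUnitaryGroup (Fin 2) ℂ)), ‖m‖ ≤ rc * (θBal F.L γ b₀ p₀ j / 4) → ‖m'‖ ≤ rc * (θBal F.L γ b₀ p₀ j / 4) → PlaqSmall (θBal F.L γ b₀ p₀ j / 4) U → PlaqSmall (θBal F.L γ b₀ p₀ j / 4) V → PlaqSmall (θBal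 F.L γ b₀ p₀ j / 4) W → PlaqSmall (θBal F.L γ b₀ p₀ j / 4) Y → PlaqSmall (θBal F.L γ b₀ p₀ j / 4) Xw → (∀ e, e ≠ B → V e = U e) → V B = U B * expPt m → (∀ e, e ≠ B' → W e = U e) → W B' = U B' * expPt m' → (∀ e, e ≠ B' → Y e = V e) → Y B' = V B' * expPt m' → ∀ (c₁ c₂ : ℝ), c₁ = ∫ z, ((Real.log (ρ Ts (Φ (V, z))) - Real.log (ρ' Ts (Φ (V, z)))) - (Real.log (ρ Ts (Φ (U, z))) - Real.log (ρ' Ts (Φ (U, z))))) * (wgt F γ b₀ p₀ j Ts ρ ρ' τ Φ J t) Xw z ∂τ → c₂ = ∫ z, ((Real.log (ρ Ts (Φ (W, z))) - Real.log (ρ' Ts (Φ (W, z)))) - (Real.log (ρ Ts (Φ (U, z))) - Real.log (ρ' Ts (Φ (U, z))))) * (wgt F γ b₀ p₀ j Ts ρ ρ' τ Φ J t) Xw z ∂τ → Integrable (fun z => (((Real.log (ρ Ts (Φ (V, z))) - Real.log (ρ' Ts (Φ (V, z)))) - (Real.log (ρ Ts (Φ (U, z))) - Real.log (ρ' Ts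 (Φ (U, z))))) - c₁) * (((Real.log (ρ Ts (Φ (W, z))) - Real.log (ρ' Ts (Φ (W, z)))) - (Real.log (ρ Ts (Φ (U, z))) - Real.log (ρ' Ts (Φ (U, z))))) - c₂) * (wgt F γ b₀ p₀ j Ts ρ ρ' τ Φ J t) Xw z) τ ∧ |∫ z, (((Real.log (ρ Ts (Φ (V, z))) - Real.log (ρ' Ts (Φ (V, z)))) - (Real.log (ρ Ts (Φ (U, z))) - Real.log (ρ' Ts (Φ (U, z))))) - c₁) * (((Real.log (ρ Ts (Φ (W, z))) - Real.log (ρ' Ts (Φ (W, z)))) - (Real.log (ρ Ts (Φ (U, z))) - Real.log (ρ' Ts (Φ (U, z))))) - c₂) * (wgt F γ b₀ p₀ j Ts ρ ρ' τ Φ J t) Xw z ∂τ| ≤ kV₂ B B' * (‖m‖ / (θBal F.L γ b₀ p₀ j / 4)) * (‖m'‖ / (θBal F.L γ b₀ p₀ j / 4))))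
∧ (∃ kV₃ : PBond (F.P j) 0 → PBond (F.P j) 0 → ℝ, (∀ B B', 0 ≤ kV₃ B B') ∧ (∀ B, ∑ B', kV₃ B B' * Real.exp (κ * (B.src.tdist B'.src : ℝ)) ≤ NV3 * ((((F.L : ℝ) ^ j / γ) * θBal F.L γ b₀ p₀ j ^ 2) / (((F.L : ℝ) ^ Ts / γ) * θBal F.L γ b₀ p₀ Ts ^ 2)) * w * (w / (((F.L : ℝ) ^ Ts / γ) * θBal F.L γ b₀ p₀ Ts ^ 2)) + δV3 j * (((F.L : ℝ) ^ j / γ) * θBal F.L γ b₀ p₀ j ^ 2)) ∧ (∀ B', ∑ B, kV₃ B B' * Real.exp (κ * (B.src.tdist B'.src : ℝ)) ≤ NV3 * ((((F.L : ℝ) ^ j / γ) * θBal F.L γ b₀ p₀ j ^ 2) / (((F.L : ℝ) ^ Ts / γ) * θBal F.L γ b₀ p₀ Ts ^ 2)) * w * (w / (((F.L : ℝ) ^ Ts / γ) * θBal F.L γ b₀ p₀ Ts ^ 2)) + δV3 j * (((F.L : ℝ) ^ j / γ) * θBal F.L γ b₀ p₀ j ^ 2)) ∧ ∀ t : ℝ,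 0 ≤ t → t ≤ 1 → (∀ (B B' : PBond (F.P j) 0) (m m' : Fin 3 → ℝ) (U₁ V₁ U₂ W₂ : GaugeField (F.P j) 0 ↥(Matrix.specialUnitaryGroup (Fin 2) ℂ)), ‖m‖ ≤ rc * (θBal F.L γ b₀ p₀ j / 4) → ‖m'‖ ≤ rc * (θBal F.L γ b₀ p₀ j / 4) → PlaqSmall (θBal F.L γ b₀ p₀ j / 4) U₁ → PlaqSmall (θBal F.L γ b₀ p₀ j / 4) V₁ → PlaqSmall (θBal F.L γ b₀ p₀ j / 4) U₂ → PlaqSmall (θBal F.L γ b₀ p₀ j / 4) W₂ → (∀ e, e ≠ B → V₁ e = U₁ e) → V₁ B = U₁ B * expPt m → (∀ e, e ≠ B' → W₂ e = U₂ e) → W₂ B' = U₂ B' * expPt m' → ∀ (c₁ e₁ c₂ e₂ : ℝ), c₁ = ∫ z, ((Real.log (ρ Ts (Φ (V₁, z))) - Real.log (ρ' Ts (Φ (V₁, z)))) - (Real.log (ρ Ts (Φ (U₁, z))) - Real.log (ρ' Ts (Φ (U₁, z))))) * (wgt F γ b₀ p₀ j Ts ρ ρ' τ Φ J t) W₂ z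 ∂τ → e₁ = ∫ z, ((Real.log (ρ Ts (Φ (V₁, z))) - Real.log (ρ' Ts (Φ (V₁, z)))) + (Real.log (ρ Ts (Φ (U₁, z))) - Real.log (ρ' Ts (Φ (U₁, z))))) * (wgt F γ b₀ p₀ j Ts ρ ρ' τ Φ J t) W₂ z ∂τ → c₂ = ∫ z, ((Real.log (ρ Ts (Φ (V₁, z))) - Real.log (ρ' Ts (Φ (V₁, z)))) - (Real.log (ρ Ts (Φ (U₁, z))) - Real.log (ρ' Ts (Φ (U₁, z))))) * (wgt F γ b₀ p₀ j Ts ρ ρ' τ Φ J t) U₂ z ∂τ → e₂ = ∫ z, ((Real.log (ρ Ts (Φ (V₁, z))) - Real.log (ρ' Ts (Φ (V₁, z)))) + (Real.log (ρ Ts (Φ (U₁, z))) - Real.log (ρ' Ts (Φ (U₁, z))))) * (wgt F γ b₀ p₀ j Ts ρ ρ' τ Φ J t) U₂ z ∂τ → Integrable (fun z => (((Real.log (ρ Ts (Φ (V₁, z))) - Real.log (ρ' Ts (Φ (V₁, z)))) - (Real.log (ρ Ts (Φ (U₁, z))) - Real.log (ρ' Ts (Φ (U₁, z))))) - c₁)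 * (((Real.log (ρ Ts (Φ (V₁, z))) - Real.log (ρ' Ts (Φ (V₁, z)))) + (Real.log (ρ Ts (Φ (U₁, z))) - Real.log (ρ' Ts (Φ (U₁, z))))) - e₁) * (wgt F γ b₀ p₀ j Ts ρ ρ' τ Φ J t) W₂ z) τ ∧ Integrable (fun z => (((Real.log (ρ Ts (Φ (V₁, z))) - Real.log (ρ' Ts (Φ (V₁, z)))) - (Real.log (ρ Ts (Φ (U₁, z))) - Real.log (ρ' Ts (Φ (U₁, z))))) - c₂) * (((Real.log (ρ Ts (Φ (V₁, z))) - Real.log (ρ' Ts (Φ (V₁, z)))) + (Real.log (ρ Ts (Φ (U₁, z))) - Real.log (ρ' Ts (Φ (U₁, z))))) - e₂) * (wgt F γ b₀ p₀ j Ts ρ ρ' τ Φ J t) U₂ z) τ ∧ |(∫ z, (((Real.log (ρ Ts (Φ (V₁, z))) - Real.log (ρ' Ts (Φ (V₁, z)))) - (Real.log (ρ Ts (Φ (U₁, z))) - Real.log (ρ' Ts (Φ (U₁, z))))) - c₁) * (((Real.log (ρ Ts (Φ (V₁, z))) - Real.log (ρ' Ts (Φ (V₁, z)))) + (Real.log (ρ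 Ts (Φ (U₁, z))) - Real.log (ρ' Ts (Φ (U₁, z))))) - e₁) * (wgt F γ b₀ p₀ j Ts ρ ρ' τ Φ J t) W₂ z ∂τ) - (∫ z, (((Real.log (ρ Ts (Φ (V₁, z))) - Real.log (ρ' Ts (Φ (V₁, z)))) - (Real.log (ρ Ts (Φ (U₁, z))) - Real.log (ρ' Ts (Φ (U₁, z))))) - c₂) * (((Real.log (ρ Ts (Φ (V₁, z))) - Real.log (ρ' Ts (Φ (V₁, z)))) + (Real.log (ρ Ts (Φ (U₁, z))) - Real.log (ρ' Ts (Φ (U₁, z))))) - e₂) * (wgt F γ b₀ p₀ j Ts ρ ρ' τ Φ J t) U₂ z ∂τ)| ≤ kV₃ B B' * (‖m‖ / (θBal F.L γ b₀ p₀ j / 4)) * (‖m'‖ / (θBal F.L γ b₀ p₀ j / 4))))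
∧ (∃ kV₄ : PBond (F.P j) 0 → PBond (F.P j) 0 → ℝ, (∀ B B', 0 ≤ kV₄ B B') ∧ (∀ B, ∑ B', kV₄ B B' * Real.exp (κ * (B.src.tdist B'.src : ℝ)) ≤ NV4 * ((((F.L : ℝ) ^ j / γ) * θBal F.L γ b₀ p₀ j ^ 2) / (((F.L : ℝ) ^ Ts / γ) * θBal F.L γ b₀ p₀ Ts ^ 2)) * w * (w / (((F.L : ℝ) ^ Ts / γ) * θBal F.L γ b₀ p₀ Ts ^ 2)) + δV4 j * (((F.L : ℝ) ^ j / γ) * θBal F.L γ b₀ p₀ j ^ 2)) ∧ ∀ t : ℝ, 0 ≤ t → t ≤ 1 → (∀ (B B' : PBond (F.P j) 0) (m m' : Fin 3 → ℝ) (V00 V10 V01 V11 : GaugeField (F.P j) 0 ↥(Matrix.specialUnitaryGroup (Fin 2) ℂ)), ‖m‖ ≤ rc * (θBal F.L γ b₀ p₀ j / 4) → ‖m'‖ ≤ rc * (θBal F.L γ b₀ p₀ j / 4) → PlaqSmall (θBal F.L γ b₀ p₀ j / 4) V00 → PlaqSmall (θBal F.L γ b₀ p₀ j / 4) V10 → PlaqSmall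 (θBal F.L γ b₀ p₀ j / 4) V01 → PlaqSmall (θBal F.L γ b₀ p₀ j / 4) V11 → (∀ e, e ≠ B → V10 e = V00 e) → V10 B = V00 B * expPt m → (∀ e, e ≠ B' → V01 e = V00 e) → V01 B' = V00 B' * expPt m' → (∀ e, e ≠ B' → V11 e = V10 e) → V11 B' = V10 B' * expPt m' → ∀ (c₀₀ c₁₀ c₀₁ c₁₁ : ℝ), c₀₀ = ∫ z, (Real.log (ρ Ts (Φ (V00, z))) - Real.log (ρ' Ts (Φ (V00, z)))) * (wgt F γ b₀ p₀ j Ts ρ ρ' τ Φ J t) V00 z ∂τ → c₁₀ = ∫ z, (Real.log (ρ Ts (Φ (V00, z))) - Real.log (ρ' Ts (Φ (V00, z)))) * (wgt F γ b₀ p₀ j Ts ρ ρ' τ Φ J t) V10 z ∂τ → c₀₁ = ∫ z, (Real.log (ρ Ts (Φ (V00, z))) - Real.log (ρ' Ts (Φ (V00, z)))) * (wgt F γ b₀ p₀ j Ts ρ ρ' τ Φ J t) V01 z ∂τ → c₁₁ = ∫ z, (Real.log (ρ Ts (Φ (V00, z))) - Real.log (ρ' Ts (Φ (V00, z)))) *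 (wgt F γ b₀ p₀ j Ts ρ ρ' τ Φ J t) V11 z ∂τ → Integrable (fun z => ((Real.log (ρ Ts (Φ (V00, z))) - Real.log (ρ' Ts (Φ (V00, z)))) - c₀₀) ^ 2 * (wgt F γ b₀ p₀ j Ts ρ ρ' τ Φ J t) V00 z) τ ∧ Integrable (fun z => ((Real.log (ρ Ts (Φ (V00, z))) - Real.log (ρ' Ts (Φ (V00, z)))) - c₁₀) ^ 2 * (wgt F γ b₀ p₀ j Ts ρ ρ' τ Φ J t) V10 z) τ ∧ Integrable (fun z => ((Real.log (ρ Ts (Φ (V00, z))) - Real.log (ρ' Ts (Φ (V00, z)))) - c₀₁) ^ 2 * (wgt F γ b₀ p₀ j Ts ρ ρ' τ Φ J t) V01 z) τ ∧ Integrable (fun z => ((Real.log (ρ Ts (Φ (V00, z))) - Real.log (ρ' Ts (Φ (V00, z)))) - c₁₁) ^ 2 * (wgt F γ b₀ p₀ j Ts ρ ρ' τ Φ J t) V11 z) τ ∧ |(∫ z, ((Real.log (ρ Ts (Φ (V00, z))) - Real.log (ρ' Ts (Φ (V00, z)))) - c₁₁) ^ 2 * (wgt F γ b₀ p₀ j Ts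 ρ ρ' τ Φ J t) V11 z ∂τ) - (∫ z, ((Real.log (ρ Ts (Φ (V00, z))) - Real.log (ρ' Ts (Φ (V00, z)))) - c₁₀) ^ 2 * (wgt F γ b₀ p₀ j Ts ρ ρ' τ Φ J t) V10 z ∂τ) - (∫ z, ((Real.log (ρ Ts (Φ (V00, z))) - Real.log (ρ' Ts (Φ (V00, z)))) - c₀₁) ^ 2 * (wgt F γ b₀ p₀ j Ts ρ ρ' τ Φ J t) V01 z ∂τ) + (∫ z, ((Real.log (ρ Ts (Φ (V00, z))) - Real.log (ρ' Ts (Φ (V00, z)))) - c₀₀) ^ 2 * (wgt F γ b₀ p₀ j Ts ρ ρ' τ Φ J t) V00 z ∂τ)| ≤ kV₄ B B' * (‖m‖ / (θBal F.L γ b₀ p₀ j / 4)) * (‖m'‖ / (θBal F.L γ b₀ p₀ j / 4)))))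


end Summit.QuantumFields.YangMills.Cruxes.FluctuationComparisonRegPrIntL.FibreLawHJ
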